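import Literature.IUT.LogThetaLattice.ThetaPilotObjects
import Literature.IUT.HodgeArakelov.GaussianSplittingMonoids
import HarnessLib

/-!
# [IUTchIII] Definition 3.8 (i): generators up to torsion of the splitting monoids of [IUTchII] Def. 4.9 (ii) /
# Cor. 3.5 (iii), and the interfaces `SplittingMonoids` / `QPilotData` instantiated by them
# (abc-iut cell, layer L6, slice [IUTchIII] §3; bridge L6-t4 ↔ L6-t2)

S. Mochizuki, *Inter-universal Teichmüller theory III*, kurims manuscript (May 2020), §3, Definition 3.8 (i),
p. 112 [claim: Mochizuki2012, status: disputed]: the Θ-pilot object is "determined by any collection,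
indexed by `v ∈ 𝕍^bad`, of generators up to torsion of the monoids `Ψ^⊥_{𝓕_lgp}(†𝓗𝓣)_v`", the q-pilot object
"by any collection, indexed by `v ∈ 𝕍^bad`, of generators up to torsion of the splitting monoid associated to
the split Frobenioid `†𝓕^⊢_{△,v}` — that is to say, … determined by the `q_v`, for `v ∈ 𝕍^bad` [cf. [IUTchI],
Example 3.2, (iv)]". The statement file `ThetaPilotObjects.lean` (abc-iut-L6-t4, p404500) types
"generator up to torsion" as `IsGeneratorUpToTorsion g` (`∀ x, ∃ t k n, 0 < k ∧ t^k = 1 ∧ x = t·g^n`) and the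
two families of monoids as the INTERFACES `SplittingMonoids M` (sub-monoids `Ψ^⊥_v ⊆ M v` with a generator
up to torsion) and `QPilotData ObΔ N` (distinguished generators `q_v` and an object-forming map) — the
binders `split` / `qData` of the Cor. 3.12 crew's `Summit.ABC.IUTFork.Cor312.Setting.ofComparison`
(abc-iut-c312-7; `HOME/plan/C312-RESIDUALS.md` §1a′). abc-iut-L6-t2 has typed the splitting monoids
themselves at the level of values: `splittingMonoidAt K 2l q j = μ_{2l}(K) · (q^{j²})^ℕ` ([IUTchII] Def. 4.9
(ii) p. 155, `SplittingMonoidValues.lean` p407350) and the tuple-level `gaussianSplittingMonoid K 2l ξ =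
μ_{2l}^{diag} · ξ^ℕ` of a value-profile `ξ` ([IUTchII] Cor. 3.5 (iii) p. 95 "a splitting up to torsion of
each of the Gaussian monoids `Ψ_ξ`"; [IUTchIII] Prop. 3.5 (ii)(c) p. 105; `GaussianSplittingMonoids.lean`
p407745). This file is the bridge:

* §1 (API) `isGeneratorUpToTorsion_powers`, `IsGeneratorUpToTorsion.map`;
  **`isGeneratorUpToTorsion_splittingMonoidAt`** — `q^{j²}` generates `μ_{2l} · q^{j²ℕ}` up to torsion
  (`2l > 0`); **`isGeneratorUpToTorsion_gaussianSplittingMonoid`** — `ξ` generates `μ_{2l}^{diag} · ξ^ℕ` up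
  to torsion; and the converse, the uniqueness up to torsion that makes "determined by ANY collection of
  generators up to torsion" well posed: against any monoid homomorphism `ord : K → ℤ` (values written
  multiplicatively) with `ord q ≠ 0` — e.g. the valuation of `K_v`, `ord_v(q_v) > 0` — EVERY generator up to
  torsion of `μ_{2l} · q^{j²ℕ}` is `ζ · q^{j²}`, `ζ ∈ μ_{2l}(K)` (**`exists_eq_root_mul_of_isGeneratorUpToTorsion`**),
  and every generator up to torsion of `μ_{2l}^{diag} · ξ^ℕ` is `diag(ω) · ξ`, `ω ∈ μ_{2l}(K)`, as soon as
  `ord ξ_{i₀} ≠ 0` for one component (**`exists_eq_diag_mul_of_isGeneratorUpToTorsion`**);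
* §2 (instances, for ANY family of commutative monoids `K_v`, elements `q_v` / profiles `ξ_v`, `v ∈ 𝕍^bad`;
  no hypothesis beyond `0 < 2l`): **`SplittingMonoids.ofProfiles K 2l _ ξ : SplittingMonoids (fun v h =>
  Fin l⋆ → K v h)`** with `Msplit v h = gaussianSplittingMonoid (K v h) 2l (ξ v h)` inside the lgp-monoid of
  tuples `∏_{j ∈ 𝔽_l^⋇} K_v`, and **`QPilotData.ofSplitting K 2l _ q objOf : QPilotData ObΔ (fun v h =>
  ↥(splittingMonoidAt (K v h) 2l (q v h) 1))`** with distinguished generators the `q_v`.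

The Dupuy–Hilado / Tate-parameter level (ambient monoids `F_vˣ`, `ord_v`, the identities with
abc-iut-c312-3's pilot divisors) is the sequel `ThetaPilotObjectsReal.lean`. Elementary monoid algebra over
landed interfaces; nothing here asserts a disputed claim or takes a side on [IUTchIII] Cor. 3.12; typed ≠
discharged; instantiated ≠ endorsed.
-/

noncomputable section

namespace Literature.IUT.LogThetaLattice

open Literature.IUT.HodgeArakelov

universe u v w

/-! ### §1 Generators up to torsion: the splitting monoids of [IUTchII] Def. 4.9 (ii) / Cor. 3.5 (iii) -/

section GenAPI

variable {K : Type u} [CommMonoid K]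

/-- In the monoid of powers `g^ℕ`, `g` is a generator up to torsion (with trivial torsion part).
[claim: Mochizuki2012, status: disputed] -/
theorem isGeneratorUpToTorsion_powers (g : K) :
    IsGeneratorUpToTorsion (⟨g, Submonoid.mem_powers g⟩ : Submonoid.powers g) := by
  rintro ⟨x, n, rfl⟩
  exact ⟨1, 1, n, Nat.one_pos, one_pow 1, Subtype.ext (by simp)⟩

/-- A surjective monoid homomorphism carries generators up to torsion to generators up to torsion.
[claim: Mochizuki2012, status: disputed] -/
theorem IsGeneratorUpToTorsion.map {N : Type v} {N' : Type w} [Monoid N] [Monoid N'] (f : N →* N')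
    (hf : Function.Surjective f) {g : N} (hg : IsGeneratorUpToTorsion g) :
    IsGeneratorUpToTorsion (f g) := by
  intro y
  obtain ⟨x, rfl⟩ := hf y
  obtain ⟨t, k, n, hk, ht, rfl⟩ := hg x
  exact ⟨f t, k, n, hk, by rw [← map_pow, ht, map_one], by rw [map_mul, map_pow]⟩

/-- **`q^{j²}` generates `μ_{2l} · q^{j²ℕ}` up to torsion** ([IUTchII] Def. 4.9 (ii) p. 155 / [IUTchIII] Def. 3.8
(i) p. 112): every element of abc-iut-L6-t2's `splittingMonoidAt K 2l q j` is a `2l`-th root of unity (an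
element of the monoid killed by the exponent `2l > 0`) times a power of `q^{j²}`; stated for any member `g`
with value `q^{j²}`. [claim: Mochizuki2012, status: disputed] -/
theorem isGeneratorUpToTorsion_splittingMonoidAt {twoL : ℕ} (htwoL : 0 < twoL) (q : K) (j : ℕ)
    (g : splittingMonoidAt K twoL q j) (hg : (g : K) = q ^ j ^ 2) : IsGeneratorUpToTorsion g := by
  rintro ⟨x, hx⟩
  obtain ⟨ζ, hζ, n, rfl⟩ := (mem_splittingMonoidAt_iff twoL q j x).mp hx
  refine ⟨⟨(ζ : K), root_mem_splittingMonoidAt twoL q j hζ⟩, twoL, n, htwoL, ?_, ?_⟩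
  · exact Subtype.ext (by simpa using (mem_rootsOfUnity' twoL ζ).mp hζ)
  · exact Subtype.ext (by simp [hg])

/-- **The value-profile `ξ` generates `μ_{2l}^{diag} · ξ^ℕ` up to torsion** ([IUTchII] Cor. 3.5 (iii) p. 95 "a
splitting up to torsion of each of the Gaussian monoids"; [IUTchIII] Prop. 3.5 (ii)(c), Def. 3.8 (i)): every
element of abc-iut-L6-t2's `gaussianSplittingMonoid K 2l ξ` is a DIAGONAL `2l`-th root of unity times a power
of `ξ`; stated for any member `g` with value `ξ`. [claim: Mochizuki2012, status: disputed] -/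
theorem isGeneratorUpToTorsion_gaussianSplittingMonoid {ι : Type v} {twoL : ℕ} (htwoL : 0 < twoL)
    (ξ : ι → K) (g : gaussianSplittingMonoid K twoL ξ) (hg : (g : ι → K) = ξ) :
    IsGeneratorUpToTorsion g := by
  rintro ⟨x, hx⟩
  obtain ⟨ω, hω, n, rfl⟩ := (mem_gaussianSplittingMonoid_iff twoL ξ x).mp hx
  have hdiag : (fun _ : ι => (ω : K)) ∈ gaussianSplittingMonoid K twoL ξ :=
    Submonoid.mem_sup_left ((mem_diagonalRoots_iff twoL _).mpr ⟨ω, hω, rfl⟩)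
  have hω1 : (ω : K) ^ twoL = 1 := (mem_rootsOfUnity' twoL ω).mp hω
  refine ⟨⟨fun _ => (ω : K), hdiag⟩, twoL, n, htwoL, ?_, ?_⟩
  · exact Subtype.ext (funext fun i => by simp [hω1])
  · exact Subtype.ext (funext fun i => by simp [hg, Pi.mul_apply, Pi.pow_apply])

/-- Torsion elements have trivial "valuation": for a monoid homomorphism `ord : K → ℤ` (written
multiplicatively, `Multiplicative ℤ`) and `t^k = 1` with `k > 0`, `ord t = 0`. [folklore] -/
private theorem ord_eq_one_of_pow_eq_one (ord : K →* Multiplicative ℤ) {t : K} {k : ℕ} (hk : 0 < k)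
    (ht : t ^ k = 1) : ord t = 1 := by
  have h : (ord t) ^ k = 1 := by rw [← map_pow ord, ht, map_one]
  have h' : k • Multiplicative.toAdd (ord t) = 0 := by rw [← toAdd_pow, h, toAdd_one]
  rcases smul_eq_zero.mp h' with h0 | h0
  · exact absurd h0 hk.ne'
  · exact Multiplicative.toAdd.injective h0

/-- Arithmetic core of the uniqueness up to torsion: in `ℤ`, `c = n • (k • c)` with `c ≠ 0` forces `k = 1`.
[folklore] -/
private theorem eq_one_of_eq_nsmul_nsmul {c : ℤ} (hc : c ≠ 0) {n k : ℕ} (h : c = n • (k • c)) : k = 1 := by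
  rw [smul_smul, nsmul_eq_mul] at h
  have h1 : ((n * k : ℕ) : ℤ) = 1 := by
    have : ((n * k : ℕ) : ℤ) * c = 1 * c := by rw [one_mul]; exact h.symm
    exact mul_right_cancel₀ hc this
  have h2 : n * k = 1 := by exact_mod_cast h1
  exact Nat.eq_one_of_mul_eq_one_left h2

/-- **Uniqueness up to torsion of the generator** (the well-posedness behind Definition 3.8 (i)'s "any
collection … of generators up to torsion", p. 112): if some monoid homomorphism `ord : K → ℤ` does not kill
`q` (e.g. the valuation of `K_v`: `ord_v(q_v) > 0`), then every generator up to torsion of `μ_{2l} · q^{j²ℕ}`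
(`2l > 0`) is `ζ · q^{j²}` with `ζ ∈ μ_{2l}(K)`. [claim: Mochizuki2012, status: disputed] -/
theorem exists_eq_root_mul_of_isGeneratorUpToTorsion (ord : K →* Multiplicative ℤ) {twoL : ℕ}
    (htwoL : 0 < twoL) {q : K} (hq : ord q ≠ 1) {j : ℕ} {g : splittingMonoidAt K twoL q j}
    (hg : IsGeneratorUpToTorsion g) :
    ∃ ζ : Kˣ, ζ ∈ rootsOfUnity twoL K ∧ (g : K) = ζ * q ^ j ^ 2 := by
  obtain ⟨ζ, hζ, k, hgk⟩ := (mem_splittingMonoidAt_iff twoL q j (g : K)).mp g.2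
  refine ⟨ζ, hζ, ?_⟩
  rcases Nat.eq_zero_or_pos j with rfl | hj
  · simpa using hgk
  obtain ⟨t, a, n, ha, hta, hqt⟩ := hg ⟨q ^ j ^ 2, thetaPower_mem_splittingMonoidAt twoL q j⟩
  have hval : (q ^ j ^ 2 : K) = (t : K) * (g : K) ^ n := by
    simpa using congrArg Subtype.val hqt
  have hordt : ord (t : K) = 1 :=
    ord_eq_one_of_pow_eq_one ord ha (by simpa using congrArg Subtype.val hta)
  have hordζ : ord (ζ : K) = 1 :=
    ord_eq_one_of_pow_eq_one ord htwoL ((mem_rootsOfUnity' twoL ζ).mp hζ)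
  set oq : ℤ := Multiplicative.toAdd (ord q) with hoq_def
  have hoq : oq ≠ 0 := fun h0 => hq (by
    apply Multiplicative.toAdd.injective
    rw [← hoq_def, h0, toAdd_one])
  have hc : ((j ^ 2 : ℕ) • oq : ℤ) ≠ 0 := by
    rw [nsmul_eq_mul]
    exact mul_ne_zero (by positivity) hoq
  have h1 : Multiplicative.toAdd (ord (q ^ j ^ 2)) = (j ^ 2 : ℕ) • oq := by
    rw [map_pow ord, toAdd_pow]
  have h2 : Multiplicative.toAdd (ord (g : K)) = k • ((j ^ 2 : ℕ) • oq) := by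
    rw [hgk, map_mul, hordζ, one_mul, map_pow ord, map_pow ord, toAdd_pow, toAdd_pow]
  have h3 : Multiplicative.toAdd (ord (q ^ j ^ 2)) = n • Multiplicative.toAdd (ord (g : K)) := by
    rw [hval, map_mul, hordt, one_mul, map_pow ord, toAdd_pow]
  rw [h1, h2] at h3
  have hk : k = 1 := eq_one_of_eq_nsmul_nsmul hc h3
  rw [hgk, hk, pow_one]

/-- **Tuple version**: every generator up to torsion of `μ_{2l}^{diag} · ξ^ℕ` (`2l > 0`) is `diag(ω) · ξ` with
`ω ∈ μ_{2l}(K)`, provided some component `ξ_{i₀}` is not killed by a monoid homomorphism `ord : K → ℤ` (the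
valuation: `ord_v(q_v^{j²}) > 0`). [claim: Mochizuki2012, status: disputed] -/
theorem exists_eq_diag_mul_of_isGeneratorUpToTorsion {ι : Type v} (ord : K →* Multiplicative ℤ)
    {twoL : ℕ} (htwoL : 0 < twoL) {ξ : ι → K} (i₀ : ι) (hξ : ord (ξ i₀) ≠ 1)
    {g : gaussianSplittingMonoid K twoL ξ} (hg : IsGeneratorUpToTorsion g) :
    ∃ ω : Kˣ, ω ∈ rootsOfUnity twoL K ∧ (g : ι → K) = fun i => (ω : K) * ξ i := by
  obtain ⟨ω, hω, k, hgk⟩ := (mem_gaussianSplittingMonoid_iff twoL ξ (g : ι → K)).mp g.2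
  refine ⟨ω, hω, ?_⟩
  obtain ⟨t, a, n, ha, hta, hξt⟩ :=
    hg ⟨ξ, by simpa using pow_mem_gaussianSplittingMonoid twoL ξ 1⟩
  have hval : ξ i₀ = (t : ι → K) i₀ * (g : ι → K) i₀ ^ n := by
    have := congrFun (congrArg Subtype.val hξt) i₀
    simpa [Pi.mul_apply, Pi.pow_apply] using this
  have hordt : ord ((t : ι → K) i₀) = 1 := by
    refine ord_eq_one_of_pow_eq_one ord ha ?_
    have := congrFun (congrArg Subtype.val hta) i₀
    simpa [Pi.pow_apply] using this
  have hordω : ord (ω : K) = 1 :=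
    ord_eq_one_of_pow_eq_one ord htwoL ((mem_rootsOfUnity' twoL ω).mp hω)
  have hg0 : (g : ι → K) i₀ = (ω : K) * ξ i₀ ^ k := by rw [hgk]
  set ox : ℤ := Multiplicative.toAdd (ord (ξ i₀)) with hox_def
  have hox : ox ≠ 0 := fun h0 => hξ (by
    apply Multiplicative.toAdd.injective
    rw [← hox_def, h0, toAdd_one])
  have h2 : Multiplicative.toAdd (ord ((g : ι → K) i₀)) = k • ox := by
    rw [hg0, map_mul, hordω, one_mul, map_pow ord, toAdd_pow]
  have h3 : ox = n • Multiplicative.toAdd (ord ((g : ι → K) i₀)) := by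
    rw [hox_def]
    conv_lhs => rw [hval]
    rw [map_mul, hordt, one_mul, map_pow ord, toAdd_pow]
  rw [h2] at h3
  have hk : k = 1 := eq_one_of_eq_nsmul_nsmul hox h3
  rw [hgk, hk]
  funext i
  simp

end GenAPI

/-! ### §2 The interfaces of `ThetaPilotObjects.lean` instantiated by the splitting monoids -/

section Instances

variable {V : Type v} {isBad : V → Prop} {lstar : ℕ}

/-- **`SplittingMonoids` from value-profiles** ([IUTchIII] Def. 3.8 (i) p. 112 over [IUTchII] Cor. 3.5 (iii)):
at each `v ∈ 𝕍^bad`, inside the lgp-monoid of tuples `∏_{j ∈ 𝔽_l^⋇} K_v` (componentwise multiplication), the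
splitting monoid `Ψ^⊥_v := μ_{2l}^{diag} · ξ_v^ℕ` of abc-iut-L6-t2 (`gaussianSplittingMonoid`) for a given
value-profile `ξ_v`, generated up to torsion by `ξ_v` itself. [claim: Mochizuki2012, status: disputed] -/
def SplittingMonoids.ofProfiles (K : ∀ v : V, isBad v → Type w) [∀ v h, CommMonoid (K v h)]
    (twoL : ℕ) (htwoL : 0 < twoL) (ξ : ∀ v h, Fin lstar → K v h) :
    SplittingMonoids (fun v h => Fin lstar → K v h) where
  Msplit v h := gaussianSplittingMonoid (K v h) twoL (ξ v h)
  exists_gen v h :=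
    ⟨⟨ξ v h, by simpa using pow_mem_gaussianSplittingMonoid twoL (ξ v h) 1⟩,
      isGeneratorUpToTorsion_gaussianSplittingMonoid htwoL (ξ v h) _ rfl⟩

/-- The splitting monoid of `SplittingMonoids.ofProfiles` at `v` is `μ_{2l}^{diag} · ξ_v^ℕ`.
[claim: Mochizuki2012, status: disputed] -/
@[simp] theorem SplittingMonoids.ofProfiles_Msplit (K : ∀ v : V, isBad v → Type w)
    [∀ v h, CommMonoid (K v h)] (twoL : ℕ) (htwoL : 0 < twoL) (ξ : ∀ v h, Fin lstar → K v h) (v : V)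
    (h : isBad v) :
    (SplittingMonoids.ofProfiles K twoL htwoL ξ).Msplit v h = gaussianSplittingMonoid (K v h) twoL (ξ v h) :=
  rfl

/-- **`QPilotData` from the `q_v`** ([IUTchIII] Def. 3.8 (i) p. 112 "determined by the `q_v`, for `v ∈ 𝕍^bad`"):
the splitting monoids `μ_{2l} · q_v^ℕ ⊆ K_v` of abc-iut-L6-t2 (`splittingMonoidAt K_v 2l q_v 1`, [IUTchII] Def. 4.9
(ii)) with distinguished generators up to torsion `q_v` and a given object-forming map `objOf`.
[claim: Mochizuki2012, status: disputed] -/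
def QPilotData.ofSplitting {ObΔ : Type w} (K : ∀ v : V, isBad v → Type w) [∀ v h, CommMonoid (K v h)]
    (twoL : ℕ) (htwoL : 0 < twoL) (q : ∀ v h, K v h)
    (objOf : (∀ v h, ↥(splittingMonoidAt (K v h) twoL (q v h) 1)) → ObΔ) :
    QPilotData ObΔ (fun v h => ↥(splittingMonoidAt (K v h) twoL (q v h) 1)) where
  q v h := ⟨q v h, by simpa using thetaPower_mem_splittingMonoidAt twoL (q v h) 1⟩
  q_gen v h := isGeneratorUpToTorsion_splittingMonoidAt htwoL (q v h) 1 _ (by simp)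
  objOf := objOf

/-- The distinguished generator of `QPilotData.ofSplitting` at `v` is `q_v`. [claim: Mochizuki2012, status: disputed] -/
@[simp] theorem QPilotData.ofSplitting_q {ObΔ : Type w} (K : ∀ v : V, isBad v → Type w)
    [∀ v h, CommMonoid (K v h)] (twoL : ℕ) (htwoL : 0 < twoL) (q : ∀ v h, K v h)
    (objOf : (∀ v h, ↥(splittingMonoidAt (K v h) twoL (q v h) 1)) → ObΔ) (v : V) (h : isBad v) :
    ((QPilotData.ofSplitting K twoL htwoL q objOf).q v h : K v h) = q v h :=
  rfl

end Instances

end Literature.IUT.LogThetaLattice
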